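import Summits.ABC.ABC.Theorems.CuspFieldPencilNFPencilOfScoones
import Summits.ABC.ABC.Theorems.CuspFieldPencilFiveTorsionDictionary
import Summits.ABC.ABC.Theorems.CuspFieldPencilFiveTorsionPayoff
import HarnessLib

/-!
# The class row of LINE 17 as one kernel declaration: Szpiro `1/2 + ε` on the rational-5-torsion class, modulo Scoones 2021

`Summits/ABC/ABC/Theorems/CuspFieldPencilClassRowOfScoones.lean` — helper toward the target
stmt-ABC-26025 `Summit.ABC.ABC.Theses.CuspFieldPencil.FiveTorsionClassEpsShape` of the (draft)
class-record route `CuspFieldPencil` (the item stays OPEN as typed — it is the UNCONDITIONAL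
class theorem; nothing here restates it). Desk default D12 (b), endorsed by director-abc g11.

`fiveTorsionClassEpsShape_of_scoones2021 (hS) : FiveTorsionClassEpsShape` — pure composition of landed
declarations: the payoff `fiveTorsionPayoff_proof : GoldenCuspShadow → FiveTorsionDictionary →
FiveTorsionClassEpsShape` (stmt-ABC-26029 ✓), the dictionary `fiveTorsionDictionary_proof`
(stmt-ABC-26028 ✓) and X1 modulo the fact, `goldenCuspShadow_of_scoones2021 (hS) : GoldenCuspShadow`
(file `CuspFieldPencilNFPencilOfScoones.lean`: `nfPencilBound_of_scoones2021` + the golden instance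
`goldenFromNFPencil_proof`, stmt-ABC-26251 ✓). So the census sentence «log|Δ_min(W)| ≤ C_ε·N_W^{1/2+ε}
for every W in the rational-5-torsion class 𝒯₅, MODULO the single cite-only refereed fact
`scoones2021_abcNumberField_classNumberOne`» is ONE kernel-checked implication.

HONESTY. CONDITIONAL (PROVED-MOD-FACT {scoones2021_abcNumberField_classNumberOne}: Scoones,
Mathematika 70 (2023) Thm 3 = arXiv:2111.07791, unproved in the tree, Baker's method over number
fields). A CLASS ε-shape on 𝒯₅ at abc distance 0 (width 0): NOT abc, NOT A-PS, NOT the all-`E` rung;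
the route's `closes` still needs the declared residual stmt-ABC-26027 (= abc, never staffed); abc moved
by 0; PROVED-MOD-FACT ≠ proved; typed ≠ proved.

References: Scoones 2023 [Scoones2023] (by name only); route text `Summits/ABC/ABC/Theses/CuspFieldPencil.lean`.
-/

set_option linter.dupNamespace false

namespace Summit.ABC.ABC.Theorems

/-- **The 𝒯₅ class row modulo Scoones (D12 (b)).** For every `ε > 0` there is `C` such that for all
coprime integers `u, w` with `uw(u² − 11uw − w²) ≠ 0` and every elliptic `W/ℚ` equal to
`⟨w − u, −uw, −uw², 0, 0⟩`: `log|Δ_min(W)| ≤ C·N_W^{1/2+ε}` — i.e.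
`Summit.ABC.ABC.Theses.CuspFieldPencil.FiveTorsionClassEpsShape` — GIVEN the named fact
`scoones2021_abcNumberField_classNumberOne` (hypothesis `hS`, by name). Composition
`fiveTorsionPayoff_proof (goldenCuspShadow_of_scoones2021 hS) fiveTorsionDictionary_proof`.
CONDITIONAL; NOT abc; abc moved by 0. [cite: Scoones2023, Thm 3 + display p. 4 — by name] -/
theorem fiveTorsionClassEpsShape_of_scoones2021
    (hS : Literature.NumberTheory.DiophantineGeometry.scoones2021_abcNumberField_classNumberOne) :
    Summit.ABC.ABC.Theses.CuspFieldPencil.FiveTorsionClassEpsShape :=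
  fiveTorsionPayoff_proof (goldenCuspShadow_of_scoones2021 hS) fiveTorsionDictionary_proof

end Summit.ABC.ABC.Theorems
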